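import Mathlib
import HarnessLib

/-!
# Ventures/CertifiedQuantumChemistry — Rows/SqrtTwoSignRule.lean: the exact sign rule of `p + q√2`
# (the `ℚ(√2)` number type `[p, q]` of the exact enclosure checker of record)

HONEST FRAMING (verbatim): certified bounds for a stated model Hamiltonian in a stated basis; not a
claim about the real molecule beyond that model. Nothing in this file asserts a value, a row or a claim
node about anything.

Seat rdm-B (gen 31), zero compute; theorems only (no `def`). Companion of `Rows/ExactLDLDecision.lean`
(the block test `ldl_psd` of `code/qchem_rdm_b/check_enclosure.py` typed as a decision over any linearly
ordered field). Besides exact rationals the checker reads field elements `[p, q] = p + q√2` of the real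
subfield `ℚ(√2)` (they arise in the EXACT optimal primal–dual pairs of the small limit programmes, format
`rdmB-exact-sdp-pair/1`, `pub-qchem-rdmb/ab-files/v38/`, whose optimal coordinates lie in `ℚ(√2)`); every
verdict branch on such a number goes through the class `F2`, whose ZERO TEST is componentwise (`z()`: `p = 0 ∧ q = 0`) and
whose SIGN is computed without any approximation of `√2`:

```
def sign(self):                       # sign of p + q*sqrt(2), p, q exact rationals
    p, q = self.p, self.q
    if q == 0: return sgn(p)
    if p == 0: return sgn(q)
    if (p > 0) == (q > 0): return 1 if p > 0 else -1
    d = p*p - 2*q*q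
    return sgn(d) if p > 0 else -sgn(d)
```

What is PROVED (0 `sorry`), reading `[p, q]` as the real number `(p : ℝ) + q * Real.sqrt 2`:

* `f2_eq_zero_iff` — `p + q√2 = 0 ↔ p = 0 ∧ q = 0` (irrationality of `√2`, Mathlib's
  `irrational_sqrt_two`): the componentwise zero test is the real one;
* `sq_ne_two_mul_sq` — for `q ≠ 0`, `p² ≠ 2q²`: in the opposite-sign branch `d = p² − 2q²` is never `0`,
  so `sgn d ∈ {−1, +1}` and the rule never returns a spurious `0`;
* the five branches, each as an `iff` (or an implication where the sign is forced):
  `f2_pos_iff_of_right_eq_zero` (`q = 0`), `f2_pos_iff_of_left_eq_zero` (`p = 0`),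
  `f2_pos_of_pos_of_pos` / `f2_neg_of_neg_of_neg` (same signs), and for opposite signs
  `f2_pos_iff_of_pos_of_neg` (`0 < p`, `q < 0`: positive iff `2q² < p²`, i.e. `sgn d`),
  `f2_neg_iff_of_pos_of_neg`, `f2_pos_iff_of_neg_of_pos` (`p < 0`, `0 < q`: positive iff `p² < 2q²`,
  i.e. `−sgn d`), `f2_neg_iff_of_neg_of_pos` — by monotonicity of squaring on the nonnegative reals and
  `(√2)² = 2`.

Arithmetic of `F2` other than the sign (sum, product `(p + q√2)(p' + q'√2) = (pp' + 2qq') + (pq' + qp')√2`,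
inverse through the conjugate over the norm `p² − 2q²`, which is non-zero by `sq_ne_two_mul_sq` unless the
element is `0`) is the field structure of `ℚ(√2) ⊂ ℝ` and needs no typing beyond Mathlib. References
(docstring-only): irrationality of `√2` (Mathlib `irrational_sqrt_two`); folklore.
-/

namespace Summit.Ventures.CertifiedQuantumChemistry

namespace SqrtTwoSign

/-- `p + q√2 = 0` for rationals `p, q` iff `p = 0` and `q = 0` (irrationality of `√2`): the zero test of
the checker's `ℚ(√2)` numbers is componentwise. [folklore] -/
theorem f2_eq_zero_iff (p q : ℚ) : (p : ℝ) + q * Real.sqrt 2 = 0 ↔ p = 0 ∧ q = 0 := by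
  constructor
  · intro h
    by_cases hq : q = 0
    · simp only [hq, Rat.cast_zero, zero_mul, add_zero, Rat.cast_eq_zero] at h
      exact ⟨h, hq⟩
    · exfalso
      have hs : Real.sqrt 2 = ((-p / q : ℚ) : ℝ) := by
        have hq' : (q : ℝ) ≠ 0 := by exact_mod_cast hq
        push_cast
        field_simp
        linarith
      exact (irrational_sqrt_two.ne_rat _) hs
  · rintro ⟨rfl, rfl⟩
    simp

/-- For `q ≠ 0`, `p² ≠ 2 q²` (again irrationality of `√2`): the comparison the sign rule makes in the
opposite-sign case is never a tie, so `sign (p² − 2q²) ∈ {−1, +1}` there. [folklore] -/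
theorem sq_ne_two_mul_sq {p q : ℚ} (hq : q ≠ 0) : p * p ≠ 2 * q * q := by
  intro h
  have hq' : (q : ℝ) ≠ 0 := by exact_mod_cast hq
  have h' : (p : ℝ) * p = 2 * q * q := by exact_mod_cast h
  have hr : (((|p / q| : ℚ) : ℝ)) ^ 2 = 2 := by
    push_cast
    rw [sq_abs, div_pow, div_eq_iff (pow_ne_zero 2 hq')]
    linear_combination h'
  have hs : Real.sqrt 2 = ((|p / q| : ℚ) : ℝ) := by
    rw [← hr, Real.sqrt_sq (by exact_mod_cast abs_nonneg _)]
  exact (irrational_sqrt_two.ne_rat _) hs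

/-- `b√2 < a ↔ 2b² < a²` for nonnegative reals (squares are monotone there; `(√2)² = 2`). [folklore] -/
private theorem mul_sqrt_two_lt_iff {a b : ℝ} (ha : 0 ≤ a) (hb : 0 ≤ b) :
    b * Real.sqrt 2 < a ↔ 2 * b * b < a * a := by
  rw [mul_self_lt_mul_self_iff (mul_nonneg hb (Real.sqrt_nonneg _)) ha]
  have h2 : b * Real.sqrt 2 * (b * Real.sqrt 2) = 2 * b * b := by
    rw [mul_mul_mul_comm, Real.mul_self_sqrt (by norm_num : (0 : ℝ) ≤ 2)]
    ring
  rw [h2]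

/-- `a < b√2 ↔ a² < 2b²` for nonnegative reals. [folklore] -/
private theorem lt_mul_sqrt_two_iff {a b : ℝ} (ha : 0 ≤ a) (hb : 0 ≤ b) :
    a < b * Real.sqrt 2 ↔ a * a < 2 * b * b := by
  rw [mul_self_lt_mul_self_iff ha (mul_nonneg hb (Real.sqrt_nonneg _))]
  have h2 : b * Real.sqrt 2 * (b * Real.sqrt 2) = 2 * b * b := by
    rw [mul_mul_mul_comm, Real.mul_self_sqrt (by norm_num : (0 : ℝ) ≤ 2)]
    ring
  rw [h2]

/-- Sign rule, branch `q = 0`: the sign of `p + q√2` is the sign of `p`. [folklore] -/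
theorem f2_pos_iff_of_right_eq_zero (p : ℚ) {q : ℚ} (hq : q = 0) :
    0 < (p : ℝ) + q * Real.sqrt 2 ↔ 0 < p := by
  subst hq
  simp

/-- Sign rule, branch `p = 0`: the sign of `p + q√2` is the sign of `q`. [folklore] -/
theorem f2_pos_iff_of_left_eq_zero {p : ℚ} (hp : p = 0) (q : ℚ) :
    0 < (p : ℝ) + q * Real.sqrt 2 ↔ 0 < q := by
  subst hp
  rw [Rat.cast_zero, zero_add, mul_pos_iff_of_pos_right (Real.sqrt_pos.mpr (by norm_num)),
    Rat.cast_pos]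

/-- Sign rule, branch "same signs, positive": `0 < p`, `0 < q` ⇒ `0 < p + q√2`. [folklore] -/
theorem f2_pos_of_pos_of_pos {p q : ℚ} (hp : 0 < p) (hq : 0 < q) : 0 < (p : ℝ) + q * Real.sqrt 2 :=
  add_pos (by exact_mod_cast hp) (mul_pos (by exact_mod_cast hq) (Real.sqrt_pos.mpr (by norm_num)))

/-- Sign rule, branch "same signs, negative": `p < 0`, `q < 0` ⇒ `p + q√2 < 0`. [folklore] -/
theorem f2_neg_of_neg_of_neg {p q : ℚ} (hp : p < 0) (hq : q < 0) : (p : ℝ) + q * Real.sqrt 2 < 0 :=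
  add_neg (by exact_mod_cast hp)
    (mul_neg_of_neg_of_pos (by exact_mod_cast hq) (Real.sqrt_pos.mpr (by norm_num)))

/-- Sign rule, branch `0 < p`, `q < 0` (the checker's `d = p² − 2q²`, verdict `sign d`):
`0 < p + q√2 ↔ 2q² < p²`. [folklore] -/
theorem f2_pos_iff_of_pos_of_neg {p q : ℚ} (hp : 0 < p) (hq : q < 0) :
    0 < (p : ℝ) + q * Real.sqrt 2 ↔ 2 * q * q < p * p := by
  have hp' : (0 : ℝ) ≤ p := by exact_mod_cast hp.le
  have hq' : (0 : ℝ) ≤ -q := by exact_mod_cast (neg_nonneg.mpr hq.le)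
  have e : 0 < (p : ℝ) + q * Real.sqrt 2 ↔ (-(q : ℝ)) * Real.sqrt 2 < p := by
    constructor <;> intro h <;> linarith
  rw [e, mul_sqrt_two_lt_iff hp' hq']
  constructor <;> intro h
  · have h' : (2 : ℝ) * q * q < p * p := by linarith
    exact_mod_cast h'
  · have h' : (2 : ℝ) * q * q < p * p := by exact_mod_cast h
    linarith

/-- Same branch, negative verdict: `0 < p`, `q < 0` ⇒ (`p + q√2 < 0 ↔ p² < 2q²`). [folklore] -/
theorem f2_neg_iff_of_pos_of_neg {p q : ℚ} (hp : 0 < p) (hq : q < 0) :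
    (p : ℝ) + q * Real.sqrt 2 < 0 ↔ p * p < 2 * q * q := by
  have hp' : (0 : ℝ) ≤ p := by exact_mod_cast hp.le
  have hq' : (0 : ℝ) ≤ -q := by exact_mod_cast (neg_nonneg.mpr hq.le)
  have e : (p : ℝ) + q * Real.sqrt 2 < 0 ↔ (p : ℝ) < (-(q : ℝ)) * Real.sqrt 2 := by
    constructor <;> intro h <;> linarith
  rw [e, lt_mul_sqrt_two_iff hp' hq']
  constructor <;> intro h
  · have h' : (p : ℝ) * p < 2 * q * q := by linarith
    exact_mod_cast h'
  · have h' : (p : ℝ) * p < 2 * q * q := by exact_mod_cast h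
    linarith

/-- Sign rule, branch `p < 0`, `0 < q` (verdict `−sign d`): `0 < p + q√2 ↔ p² < 2q²`. [folklore] -/
theorem f2_pos_iff_of_neg_of_pos {p q : ℚ} (hp : p < 0) (hq : 0 < q) :
    0 < (p : ℝ) + q * Real.sqrt 2 ↔ p * p < 2 * q * q := by
  have hp' : (0 : ℝ) ≤ -p := by exact_mod_cast (neg_nonneg.mpr hp.le)
  have hq' : (0 : ℝ) ≤ q := by exact_mod_cast hq.le
  have e : 0 < (p : ℝ) + q * Real.sqrt 2 ↔ (-(p : ℝ)) < q * Real.sqrt 2 := by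
    constructor <;> intro h <;> linarith
  rw [e, lt_mul_sqrt_two_iff hp' hq']
  constructor <;> intro h
  · have h' : (p : ℝ) * p < 2 * q * q := by linarith
    exact_mod_cast h'
  · have h' : (p : ℝ) * p < 2 * q * q := by exact_mod_cast h
    linarith

/-- Same branch, negative verdict: `p < 0`, `0 < q` ⇒ (`p + q√2 < 0 ↔ 2q² < p²`). [folklore] -/
theorem f2_neg_iff_of_neg_of_pos {p q : ℚ} (hp : p < 0) (hq : 0 < q) :
    (p : ℝ) + q * Real.sqrt 2 < 0 ↔ 2 * q * q < p * p := by
  have hp' : (0 : ℝ) ≤ -p := by exact_mod_cast (neg_nonneg.mpr hp.le)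
  have hq' : (0 : ℝ) ≤ q := by exact_mod_cast hq.le
  have e : (p : ℝ) + q * Real.sqrt 2 < 0 ↔ (q : ℝ) * Real.sqrt 2 < -(p : ℝ) := by
    constructor <;> intro h <;> linarith
  rw [e, mul_sqrt_two_lt_iff hp' hq']
  constructor <;> intro h
  · have h' : (2 : ℝ) * q * q < p * p := by linarith
    exact_mod_cast h'
  · have h' : (2 : ℝ) * q * q < p * p := by exact_mod_cast h
    linarith

end SqrtTwoSign

end Summit.Ventures.CertifiedQuantumChemistry
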